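import Mathlib
import HarnessLib
import Summits.Ventures.LatticeQCDFlow.Exactness.NCMCGeneralSpaceMonotoneRootCLT
import Summits.Ventures.LatticeQCDFlow.Exactness.NCMCGeneralSpaceBennettBlocksRootSummand

/-!
# The self-consistent Bennett estimate with unequal sample sizes `nf : nr = a : b`: strong consistency and asymptotic normality at Bennett's bound

HONEST FRAMING: exact (Metropolis-corrected) sampling algorithms for lattice gauge theory;
figures of merit are autocorrelation/cost numbers at stated couplings and volumes; no
continuum-physics claim.

Venture `LatticeQCDFlow` (cell pub-lqcd), topic `Exactness`; FANOUT row 13 (`eng-snf`, GEN-15).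
NEW WORK of the cell (instantiation of the abstract monotone-root files), not a published result;
nothing is cited as a fact (C. H. Bennett, J. Comput. Phys. 22 (1976) 245 named only).  Removes the
"paired (`nf = nr`) only" restriction of GEN-15 (38)/(40b): the engine's `snf.estimators.bar` with
`nf` forward and `nr` reverse works solves the finite file's `barFn (log(nf/nr))`; with
`nf = a·n`, `nr = b·n` this is the root of `Σ_{i<n} ψ_d(ω i) = 0` over `n` independent BLOCKS
`ω i ∈ (Fin a → E) × (Fin b → E)` of `a` forward and `b` reverse evolutions
(law `Measure.infinitePi (fun _ => P_F^{⊗a} ⊗ P_R^{⊗b})`), `ψ_d` the block summand of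
`NCMCGeneralSpaceBennettBlocksRootSummand.lean` with shift `M = log(a/b)`.

## Content

* **`exists_measurable_barRoot_blocks`** — a measurable root selection of the block equation exists.
* **`CrooksPair.tendsto_barRoot_blocks_ae`** — STRONG CONSISTENCY: for every Crooks pair with
  `e^{−ΔF} = Z₁/Z₀`, along almost every run of independent blocks EVERY sequence solving the block
  Bennett equation for all large `n` converges to `ΔF` (`…MonotoneRootConsistency.tendsto_root_ae`;
  population root `ΔF` by `CrooksPair.integral_blocksSummand_freeEnergy`).
* **`CrooksPair.tendstoInDistribution_sqrt_mul_barRoot_blocks_sub`** — ASYMPTOTIC NORMALITY AT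
  BENNETT'S BOUND: for any measurable root selection `ΔF̂_n`,
  `√n (ΔF̂_n − ΔF) →d N(0, 1/G_{a,b} − 1/a − 1/b)`, `G_{a,b} = E_{P_R}[(e^{ΔF−W}/a + 1/b)⁻¹]` — the
  left side of GEN-11's `bennett_lower_bound` at `nf = a`, `nr = b`: with `nf = a n` forward and
  `nr = b n` reverse independent evolutions the self-consistent BAR estimate has asymptotic variance
  `(1/G_{a,b} − 1/a − 1/b)/n = 1/(n G_{a,b}) − 1/nf − 1/nr`, Bennett's formula, and no fixed-statistic
  two-sample estimator with those sample sizes has less (`…TwoSampleBlocksCLT`, GEN-14 (35a), gives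
  `V_{a,b}(α) ≥` this bound for every `α`).

Scope / NOT CLAIMED: fixed ratio `a : b` (the two-index limit `nf, nr → ∞` independently is not
typed); independent evolutions; no rate, no studentization in this file; no value for any protocol.
-/

namespace Summit.Ventures.LatticeQCDFlow.Exactness.GeneralNCMC

open MeasureTheory ProbabilityTheory Set Filter Finset
open scoped ENNReal NNReal Topology

variable {E : Type*} [MeasurableSpace E]

/-- **A measurable root selection of the block Bennett equation exists** (`a, b ≥ 1`). -/
theorem exists_measurable_barRoot_blocks {W : E → ℝ} (hW : Measurable W) (M : ℝ) {a b : ℕ}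
    (ha : 0 < a) (hb : 0 < b) :
    ∃ dhat : ℕ → (ℕ → (Fin a → E) × (Fin b → E)) → ℝ, (∀ n, Measurable (dhat n)) ∧
      ∀ n, 1 ≤ n → ∀ ω, ∑ i ∈ range n, ((∑ l, Real.sigmoid (dhat n ω - M - W ((ω i).1 l))) -
        ∑ l, Real.sigmoid (W ((ω i).2 l) - (dhat n ω - M))) = 0 :=
  exists_measurable_root (ψ := fun d (p : (Fin a → E) × (Fin b → E)) =>
      (∑ l, Real.sigmoid (d - M - W (p.1 l))) - ∑ l, Real.sigmoid (W (p.2 l) - (d - M)))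
    (measurable_blocksSummand M hW) (blocksSummand_strictMono W M ha)
    (fun _ hn ω => exists_blocksSummand_root W M ha hb hn ω)

namespace CrooksPair

variable {Ω : Type*} [MeasurableSpace Ω]
variable {ν₀ ν₁ : Measure Ω} {κF κR : Kernel Ω E} {s e : E → Ω} {W : E → ℝ} {a b : ℕ}
variable {Ω' : Type*} [MeasurableSpace Ω'] {P' : Measure Ω'} [IsProbabilityMeasure P']

/-- **Strong consistency of the self-consistent Bennett estimate with `nf : nr = a : b`.**  For every
Crooks pair with `e^{−ΔF} = Z₁/Z₀`: along almost every run of independent blocks of `a` forward and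
`b` reverse evolutions, EVERY sequence `d_n` solving the block Bennett equation (shift
`M = log(a/b)`) for all large `n` converges to `ΔF`. -/
theorem tendsto_barRoot_blocks_ae [IsFiniteMeasure ν₀] [IsFiniteMeasure ν₁]
    [IsMarkovKernel κF] [IsMarkovKernel κR] (h0 : ν₀ univ ≠ 0) (h1 : ν₁ univ ≠ 0)
    (h : CrooksPair ν₀ ν₁ κF κR s e W) {ΔF : ℝ}
    (hΔF : Real.exp (-ΔF) = ((ν₀ univ)⁻¹ * ν₁ univ).toReal) (ha : 0 < a) (hb : 0 < b) :
    haveI := isProbabilityMeasure_fwdPathLaw ν₀ h0 κF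
    haveI := isProbabilityMeasure_fwdPathLaw ν₁ h1 κR
    ∀ᵐ ω ∂(Measure.infinitePi fun _ : ℕ =>
        (Measure.pi fun _ : Fin a => fwdPathLaw ν₀ κF).prod (Measure.pi fun _ : Fin b => fwdPathLaw ν₁ κR)),
      ∀ dseq : ℕ → ℝ,
        (∀ᶠ n : ℕ in atTop, ∑ i ∈ range n,
          ((∑ l, Real.sigmoid (dseq n - Real.log ((a : ℝ) / b) - W ((ω i).1 l))) -
            ∑ l, Real.sigmoid (W ((ω i).2 l) - (dseq n - Real.log ((a : ℝ) / b)))) = 0) →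
        Tendsto dseq atTop (𝓝 ΔF) := by
  haveI := isProbabilityMeasure_fwdPathLaw ν₀ h0 κF
  haveI := isProbabilityMeasure_fwdPathLaw ν₁ h1 κR
  exact tendsto_root_ae
    ((Measure.pi fun _ : Fin a => fwdPathLaw ν₀ κF).prod (Measure.pi fun _ : Fin b => fwdPathLaw ν₁ κR))
    (ψ := fun d (p : (Fin a → E) × (Fin b → E)) =>
      (∑ l, Real.sigmoid (d - Real.log ((a : ℝ) / b) - W (p.1 l))) -
        ∑ l, Real.sigmoid (W (p.2 l) - (d - Real.log ((a : ℝ) / b))))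
    (measurable_blocksSummand _ h.measurable_W) (blocksSummand_strictMono W _ ha)
    (integrable_blocksSummand _ h.measurable_W _)
    (h.integral_blocksSummand_freeEnergy h0 h1 hΔF ha hb)

/-- **Asymptotic normality of the self-consistent Bennett estimate with `nf : nr = a : b`; it attains
Bennett's bound.**  For every Crooks pair with `e^{−ΔF} = Z₁/Z₀` and every measurable root selection
`ΔF̂_n` of the block Bennett equation (shift `log(a/b)`), along independent blocks
`√n (ΔF̂_n − ΔF) →d N(0, 1/G_{a,b} − 1/a − 1/b)` with `G_{a,b} = E_{P_R}[(e^{ΔF−W}/a + 1/b)⁻¹]`. -/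
theorem tendstoInDistribution_sqrt_mul_barRoot_blocks_sub [IsFiniteMeasure ν₀] [IsFiniteMeasure ν₁]
    [IsMarkovKernel κF] [IsMarkovKernel κR] (h0 : ν₀ univ ≠ 0) (h1 : ν₁ univ ≠ 0)
    (h : CrooksPair ν₀ ν₁ κF κR s e W) {ΔF : ℝ}
    (hΔF : Real.exp (-ΔF) = ((ν₀ univ)⁻¹ * ν₁ univ).toReal) (ha : 0 < a) (hb : 0 < b)
    {dhat : ℕ → (ℕ → (Fin a → E) × (Fin b → E)) → ℝ} (hdm : ∀ n, Measurable (dhat n))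
    (hdhat : ∀ n, 1 ≤ n → ∀ ω, ∑ i ∈ range n,
      ((∑ l, Real.sigmoid (dhat n ω - Real.log ((a : ℝ) / b) - W ((ω i).1 l))) -
        ∑ l, Real.sigmoid (W ((ω i).2 l) - (dhat n ω - Real.log ((a : ℝ) / b)))) = 0)
    {Y : Ω' → ℝ}
    (hY : HasLaw Y (gaussianReal 0
      (1 / (∫ ε, (Real.exp (ΔF - W ε) / a + 1 / b)⁻¹ ∂(fwdPathLaw ν₁ κR)) - 1 / a - 1 / b).toNNReal) P') :
    haveI := isProbabilityMeasure_fwdPathLaw ν₀ h0 κF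
    haveI := isProbabilityMeasure_fwdPathLaw ν₁ h1 κR
    TendstoInDistribution (fun (n : ℕ) (ω : ℕ → (Fin a → E) × (Fin b → E)) => √(n : ℝ) * (dhat n ω - ΔF))
      atTop Y (fun _ => Measure.infinitePi fun _ : ℕ =>
        (Measure.pi fun _ : Fin a => fwdPathLaw ν₀ κF).prod (Measure.pi fun _ : Fin b => fwdPathLaw ν₁ κR)) P' := by
  haveI := isProbabilityMeasure_fwdPathLaw ν₀ h0 κF
  haveI := isProbabilityMeasure_fwdPathLaw ν₁ h1 κR
  set M := Real.log ((a : ℝ) / b) with hM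
  set μ := (Measure.pi fun _ : Fin a => fwdPathLaw ν₀ κF).prod (Measure.pi fun _ : Fin b => fwdPathLaw ν₁ κR)
    with hμ
  have ha' : (0 : ℝ) < a := by exact_mod_cast ha
  have hc : (a : ℝ) * Real.exp (ΔF - M - ΔF) = b := mul_exp_sub_log_div ha hb ΔF
  -- the abstract hypotheses
  have hmeas := fun d => measurable_blocksSummand (a := a) (b := b) M h.measurable_W d
  have hstrict := blocksSummand_strictMono (b := b) W M ha
  have hint := fun d => integrable_blocksSummand (a := a) (b := b) M h.measurable_W μ d
  have hroot := h.integral_blocksSummand_freeEnergy h0 h1 hΔF ha hb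
  have hψ2 : MemLp (fun p : (Fin a → E) × (Fin b → E) => (∑ l, Real.sigmoid (ΔF - M - W (p.1 l))) -
      ∑ l, Real.sigmoid (W (p.2 l) - (ΔF - M))) 2 μ :=
    MemLp.of_bound (hmeas ΔF).aestronglyMeasurable ((a : ℝ) + b)
      (Eventually.of_forall fun p => by rw [Real.norm_eq_abs]; exact abs_blocksSummand_le W M ΔF p)
  have hφm := measurable_blocksDeriv (a := a) (b := b) M h.measurable_W ΔF
  have hφi := integrable_blocksDeriv (a := a) (b := b) M h.measurable_W μ ΔF
  have hκ_eq := integral_blocksDeriv (fwdPathLaw ν₀ κF) (fwdPathLaw ν₁ κR) M (a := a) (b := b)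
    h.measurable_W ΔF
  have hκ : 0 < ∫ p, ((∑ l, Real.sigmoid (ΔF - M - W (p.1 l)) * (1 - Real.sigmoid (ΔF - M - W (p.1 l)))) +
      ∑ l, Real.sigmoid (W (p.2 l) - (ΔF - M)) * (1 - Real.sigmoid (W (p.2 l) - (ΔF - M)))) ∂μ := by
    rw [hμ, hκ_eq, h.blocksSensitivity_eq h0 h1 hΔF ha' hc]
    exact h.mul_overlap_pos h0 ha' _
  -- the asymptotic variance is Bennett's bound at `(a, b)`
  have hvar : Var[fun p : (Fin a → E) × (Fin b → E) => (∑ l, Real.sigmoid (ΔF - M - W (p.1 l))) -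
      ∑ l, Real.sigmoid (W (p.2 l) - (ΔF - M)); μ] /
      (∫ p, ((∑ l, Real.sigmoid (ΔF - M - W (p.1 l)) * (1 - Real.sigmoid (ΔF - M - W (p.1 l)))) +
        ∑ l, Real.sigmoid (W (p.2 l) - (ΔF - M)) * (1 - Real.sigmoid (W (p.2 l) - (ΔF - M)))) ∂μ) ^ 2 =
      1 / (∫ ε, (Real.exp (ΔF - W ε) / a + 1 / b)⁻¹ ∂(fwdPathLaw ν₁ κR)) - 1 / a - 1 / b := by
    rw [hμ, hκ_eq, variance_blocksSummand (fwdPathLaw ν₀ κF) (fwdPathLaw ν₁ κR) M h.measurable_W ΔF]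
    exact h.blocksNoise_div_sensitivity_sq_eq_bennett_bound h0 h1 hΔF ha' hc
  rw [← hvar] at hY
  exact tendstoInDistribution_sqrt_mul_root_sub μ hmeas hstrict hint hroot hψ2 hφm hφi hκ
    (L := ((a : ℝ) + b) / 4) (by positivity) (fun p d' => abs_blocksSummand_taylor_le W M ΔF d' p)
    hdm hdhat hY

end CrooksPair

end Summit.Ventures.LatticeQCDFlow.Exactness.GeneralNCMC
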